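import Literature.MathematicalPhysics.QuantumFieldTheory.Balaban1983to89.B6SectALemma24TwoLevelV1Sites
import Literature.MathematicalPhysics.QuantumFieldTheory.Balaban1983to89.B9LocalLemma24AtLettersY

/-!
# `Balaban1983to89.B9LocalLemma24TwoLevelAtLettersY` — T. Bałaban, *Propagators and renormalization transformations for lattice gauge theories. II*,
# Commun. Math. Phys. **96** (1984) 223–250 [Balaban1984PropagatorsII], Lemma 2.4 (2.128) p. 245 LOCALISED AT A TWO-LEVEL CUBE (2.89) p. 239 and read on def-Y's box
# kernels: **`κ·Σ_b v(b)² ≤ Σ_p ((curlK·v)(p))² + Σ_ι w(ι)·((qK·v)(ι))²` for every real bond field `v` axially gauged on the cube's blocks of BOTH levels and carried by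
# the bonds meeting them** — the LOCAL LEMMA-2.4 LETTER (Rᴸ²⁴) of row 17's centre number `m_□` ([B9] Thm 3.11's local road) for cubes MEETING `Ω_{j+1}`

T. Bałaban, *Propagators for lattice gauge theories in a background field*, Commun. Math. Phys. **99** (1985) 389–434 [Balaban1985BackgroundPropagators] p. 416;
[4] = [Balaban1984PropagatorsII].  Statement-level skeleton with citation tags; proofs where landed; nothing here is a claim about the Yang–Mills mass gap.

THE PRINT (verbatim).  [Balaban1984PropagatorsII] p. 245, Lemma 2.4 (2.128): *«L^{d−2} Σ_{c∈Λ′} |(Q₁B)(c)|² + Σ_p |(∂₁B)(p)|² ≥ (1∕(12d²)) L^{−d−1} ‖B‖²»*; p. 239,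
(2.89): *«We define B^j(Λ) = □̃ ∩ B^{j+1}(Λ_{j+1}), (2.89) and we take Q′*aQ′, Q*aQ equal to Q′*_{j+1}a_{j+1}Q′_{j+1}, Q*_{j+1}a_{j+1}Q_{j+1} on B^j(Λ), and to Q′*_ja_jQ′_j,
Q*_ja_jQ_j on □̃ ∖ B^j(Λ)»* (the two-level cube).

WHY THIS FILE (cell context, 2026-08-28).  dag-n06-j g24 closed row 17's local centre number at `U = 1` for ONE-LEVEL cubes (`B9LocalLemma24AtLettersY.local_lemma24_real` →
`Summits/…/BalabanUVNodesN06Row17LocalCentreOfLemma24Letter`), leaving the interface cubes to dag-n10-c's ROAD «C» station C6 (bus 2026-08-28T19:07Z).  C6b∕C6c∕C6d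
(`B6Lemma24TwoScale`, `B6SectALemma24TwoLevelV1`, `B6SectALemma24TwoLevelV1Sites`) give the two-scale Lemma-2.4 letter of C1 on the V1 carriers with torus-side
hypotheses; THIS FILE is its def-Y reading — the TWO-LEVEL twin of `local_lemma24_real`, same wrapper (`WithLp.toLp`, `curlK_mulVec_apply_eq`, `Node00.qK_mulVec`):
★★★ `local_lemma24_real_twoLevel`.  IMPORTS `B6SectALemma24TwoLevelV1Sites` (C6d, p660289) and `B9LocalLemma24AtLettersY` (n06-j, p657507: `curlK_mulVec_apply_eq`, the
def-Y opens); nothing restated.  Cell `pub-ymgap` (D-0062), node N10 ROAD «C» × N06 [B9] row 17, seat `pub-ymgap-dag-n10-c` gen 18, filed `--supports stmt-QuantumFields-27364`.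
HONEST SCOPE.  Transport of landed kernel theorems (C6b–C6d); the cube hypotheses (the two block sets, the label margins — one big block off the box boundary, wrapping
cubes via the torus charts —, the `LamBond` index facts, the weight floor) are DISPLAYED geometric facts about the cube, not proved here; constants ours and LEVEL-DEPENDENT;
NOT a node discharge; count-neutral; one finite 𝕋⁴ programme — nothing about the mass gap.  No `sorry`∕`axiom`∕`instance`∕`def`.
-/

open scoped InnerProductSpace

namespace Literature.MathematicalPhysics.QuantumFieldTheory.Balaban1983to89.B9LocalLemma24TwoLevelAtLettersY

open Literature.MathematicalPhysics.QuantumFieldTheory.Balaban1983to89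
open LatticeFieldCalculus B5Eq118OneStroke B5Eq120IterProof B6SectADomainsV1 B6SectAOperatorsV1
open Literature.MathematicalPhysics.QuantumFieldTheory.BalabanImbrieJaffe1984to88.BIJ85AxialPropagator411 (BondSpace)
open Literature.MathematicalPhysics.QuantumFieldTheory.Balaban1983to89.B6SectALemma24OneLevelV1 (cornerV1 normSq_dcE_eq)
open Literature.MathematicalPhysics.QuantumFieldTheory.Balaban1983to89.B6SectALemma24TwoLevelV1Sites (lemma24_letter_twoLevel_sites)
open Literature.MathematicalPhysics.QuantumFieldTheory.Balaban1983to89.B9LocalLemma24AtLettersY (curlK_mulVec_apply_eq)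

noncomputable section

section DefY

open Node00 B6KLevelCensusIndexV1 B6GlobalChartV1
open scoped Matrix

variable {d ℓ : ℕ} {hd : 1 ≤ d + 1} {hL : Odd (ℓ + 1) ∧ 1 < ℓ + 1} {b₀ b₁ : ℝ} (i : KIdx d ℓ hd hL b₀ b₁)

/-- ★★★ **THE LOCAL LEMMA-2.4 LETTER (Rᴸ²⁴) AT def-Y's BOX FOR A CUBE MEETING `Ω_{j+1}`** (the two-level twin of `B9LocalLemma24AtLettersY.local_lemma24_real`).  Let
`j + 1 ≤ k`; let `S ⊆ T^{(j)}` be the cube's blocks of order `j` and `T ⊆ T^{(j+1)}` its blocks of order `j+1` (INCLUDING the empty big blocks of `Ω_{j+1}` adjacent to its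
level-`j` part), `blockOf y ∉ T` for `y ∈ S`; label margins of one big block off the box boundary (`hboxS`, `hboxT` — wrapping cubes go through the torus charts); the INDEX
FACTS: every bond of `T^{(j)}` with an end in `S` and no end block in `T` is a member index bond of level `j` (`hIS`), every bond of `T^{(j+1)}` meeting `T` one of level
`j+1` (`hIB`); the member's weights `≥ w₀ > 0`.  Then every real bond field `v` carried by bonds with an end point in a block of `S` or `T` (`hoff`) and with vanishing
corner staircase sums on those blocks satisfies **`κ·Σ_b v(b)² ≤ Σ_p ((curlK·v)(p))² + Σ_ι w(ι)·((qK·v)(ι))²`,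
`κ = (12(d+1)²(1 + 12(d+1)·L^{2j}))⁻¹·((L^{j+1})^{d+2})⁻¹·min(c_f²∕2, w₀∕(L^{j+1})^{d−1})`** (`L = ℓ+1`).
[cite: Balaban1984PropagatorsII, Lemma 2.4 (2.128) p.245, (2.89) p.239, (2.121) p.244, (2.18)–(2.20) p.226, (2.3) p.224; Balaban1984PropagatorsI, (1.18) p.20] -/
theorem local_lemma24_real_twoLevel (hd2 : 2 ≤ d + 1) {j : ℕ} (hjk : j + 1 ≤ (domT i.hN i.D i.hk).k)
    (S : Finset (Site (PV d ℓ i.m i.K hd hL) j)) (T : Finset (Site (PV d ℓ i.m i.K hd hL) (j + 1)))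
    (hST : ∀ y ∈ S, blockOf y ∉ T)
    (hboxS : ∀ y ∈ S, ∀ μ, (ℓ + 1) ^ (j + 1) ≤ (y μ).val * (ℓ + 1) ^ j ∧
      (y μ).val * (ℓ + 1) ^ j + (ℓ + 1) ^ j + (ℓ + 1) ^ (j + 1) ≤ (PV d ℓ i.m i.K hd hL).sitesPerDir 0)
    (hboxT : ∀ Y ∈ T, ∀ μ, (ℓ + 1) ^ (j + 1) ≤ (Y μ).val * (ℓ + 1) ^ (j + 1) ∧
      (Y μ).val * (ℓ + 1) ^ (j + 1) + 2 * (ℓ + 1) ^ (j + 1) ≤ (PV d ℓ i.m i.K hd hL).sitesPerDir 0)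
    (hIS : ∀ bb : PBond (PV d ℓ i.m i.K hd hL) j, (bb.src ∈ S ∨ bb.tgt ∈ S) → blockOf bb.src ∉ T → blockOf bb.tgt ∉ T →
      (domT i.hN i.D i.hk).LamBond j bb)
    (hIB : ∀ BB : PBond (PV d ℓ i.m i.K hd hL) (j + 1), (BB.src ∈ T ∨ BB.tgt ∈ T) → (domT i.hN i.D i.hk).LamBond (j + 1) BB)
    {w₀ : ℝ} (hw₀ : 0 < w₀) (hw : ∀ ι : IBondY i, w₀ ≤ i.w ι) (v : FBondY i → ℝ)
    (hoff : ∀ b : FBondY i, v b ≠ 0 →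
      (∃ y ∈ S, b.src ∈ iterBlock j y ∨ b.tgt ∈ iterBlock j y) ∨ (∃ Y ∈ T, b.src ∈ iterBlock (j + 1) Y ∨ b.tgt ∈ iterBlock (j + 1) Y))
    (hTs : ∀ y ∈ S, ∀ x ∈ iterBlock j y, stairSum v (cornerV1 j y) x = 0)
    (hTb : ∀ Y ∈ T, ∀ x ∈ iterBlock (j + 1) Y, stairSum v (cornerV1 (j + 1) Y) x = 0) :
    (12 * (((d + 1 : ℕ) : ℝ)) ^ 2 * (1 + 12 * (((d + 1 : ℕ) : ℝ)) * ((((ℓ + 1 : ℕ) : ℝ)) ^ j) ^ 2))⁻¹ *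
          (((((ℓ + 1 : ℕ) : ℝ)) ^ (j + 1)) ^ (d + 1 + 1))⁻¹ * min (i.cf ^ 2 / 2) (w₀ / ((((ℓ + 1 : ℕ) : ℝ)) ^ (j + 1)) ^ (d + 1 - 2)) *
        ∑ b, v b ^ 2 ≤
      ∑ p, (curlK i *ᵥ v) p ^ 2 + ∑ ι, i.w ι * (qK i *ᵥ v) ι ^ 2 := by
  classical
  have h := lemma24_letter_twoLevel_sites (P := PV d ℓ i.m i.K hd hL) hd2 (domT i.hN i.D i.hk) hjk S T hST hboxS hboxT hIS hIB i.cf hw₀.le hw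
    (WithLp.toLp 2 v) (fun b hb => hoff b (by rwa [WithLp.ofLp_toLp] at hb))
    (fun y hy x hx => by rw [WithLp.ofLp_toLp]; exact hTs y hy x hx) (fun Y hY x hx => by rw [WithLp.ofLp_toLp]; exact hTb Y hY x hx)
  rw [normSq_dcE_eq, WithLp.ofLp_toLp, EuclideanSpace.real_norm_sq_eq] at h
  -- the curl term and the averaging term at def-Y's kernels
  have hcurl : ∑ p, (curlK i *ᵥ v) p ^ 2 = i.cf ^ 2 * ∑ p : Plaq (PV d ℓ i.m i.K hd hL) 0, LatticeFieldCalculus.curl 1 v p ^ 2 := by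
    rw [Finset.mul_sum]
    exact Finset.sum_congr rfl fun p _ => by rw [curlK_mulVec_apply_eq]; ring
  have hQ : ∑ ι, i.w ι * (qK i *ᵥ v) ι ^ 2 = ∑ ι, i.w ι * QE (domT i.hN i.D i.hk) (WithLp.toLp 2 v) ι ^ 2 :=
    Finset.sum_congr rfl fun ι _ => by rw [qK_mulVec, QE_apply, WithLp.ofLp_toLp]
  rw [hcurl, hQ]
  simpa only [WithLp.ofLp_toLp] using h

/-- the two-level local Lemma-2.4 constant is positive. [cite: Balaban1984PropagatorsII, Lemma 2.4 (2.128) p.245; folklore] -/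
theorem local_lemma24_twoLevel_const_pos (j : ℕ) {w₀ : ℝ} (hw₀ : 0 < w₀) :
    0 < (12 * (((d + 1 : ℕ) : ℝ)) ^ 2 * (1 + 12 * (((d + 1 : ℕ) : ℝ)) * ((((ℓ + 1 : ℕ) : ℝ)) ^ j) ^ 2))⁻¹ *
      (((((ℓ + 1 : ℕ) : ℝ)) ^ (j + 1)) ^ (d + 1 + 1))⁻¹ * min (i.cf ^ 2 / 2) (w₀ / ((((ℓ + 1 : ℕ) : ℝ)) ^ (j + 1)) ^ (d + 1 - 2)) := by
  have hL : (0 : ℝ) < (((ℓ + 1 : ℕ) : ℝ)) := by exact_mod_cast Nat.succ_pos ℓ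
  have hd' : (0 : ℝ) < (((d + 1 : ℕ) : ℝ)) := by exact_mod_cast Nat.succ_pos d
  have hmin : 0 < min (i.cf ^ 2 / 2) (w₀ / ((((ℓ + 1 : ℕ) : ℝ)) ^ (j + 1)) ^ (d + 1 - 2)) :=
    lt_min (by have := sq_pos_iff.mpr i.hcf; positivity) (div_pos hw₀ (by positivity))
  positivity

end DefY

end

end Literature.MathematicalPhysics.QuantumFieldTheory.Balaban1983to89.B9LocalLemma24TwoLevelAtLettersY
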